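import Summits.HodgeConjecture.HodgeConjecture.Theorems.NikulinTwinTransportTwinTwistorTransportReduction
import Summits.HodgeConjecture.HodgeConjecture.Theorems.NikulinTwinTransportNikulinSerreCarrierBlockCriterionLattice
import Literature.AlgebraicGeometry.Surfaces.PolarisedK3TwinKuranishiFamily

/-!
# Route NikulinTwinTransport · crux `TwinTwistorTransport` (stmt-HodgeConjecture-14393) —
# line `reduced-virtual-count-twin-locus`, stub `stub_periodDomainLocPathConnected`
# (the polarised period domain `D_h` is locally path-connected)

The registered stub `stub_periodDomainLocPathConnected` of
`Cruxes/TwinTwistorTransport/Lines/reduced_virtual_count_twin_locus.lean`, proved symbol for symbol: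
for `h ∈ Λ`, `x₀ ∈ D_h = polarisedPeriodDomain h` and `ε > 0` there is an open `V ∋ x₀` such that
every `z ∈ V ∩ D_h` is joined to `x₀` by a path inside `D_h ∩ B(x₀, ε)` (`JoinedIn`), i.e. `D_h` is
locally path-connected in the quantitative form consumed by the line's composition. (Huybrechts,
*Lectures on K3 Surfaces*, Ch. 6 §1.1 and §2.4: `D` and `D_h = D ∩ ℙ(h_ℂ^⊥)` are complex manifolds —
open subsets of smooth quadrics; here only the elementary consequence "manifold ⇒ locally
path-connected" is needed, and it is proved directly by explicit paths.)

PROOF (finite-dimensional real analysis on `Λ_ℝ`; `B` = the real K3 form of `K3TwistorLines`).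
By `mem_k3PeriodDomain_iff_k3RForm` (Huybrechts Ch. 6 Prop. 1.5), `x = a + ib ∈ D_h` iff
`(a.b) = 0`, `(a.a) = (b.b) > 0` and `a, b ⊥ h` (`mem_polarisedPeriodDomain_iff_k3RForm`). Given
`x₀ = a₀ + ib₀ ∈ D_h` and `z = a₁ + ib₁`, put, for `t ∈ [0, 1]`,
`a_t = (1−t)a₀ + t a₁`, `c_t = (1−t)b₀ + t b₁`, `b′_t = c_t − ((c_t.a_t)/(a_t.a_t)) a_t`
(Gram–Schmidt, `b′_t ⊥ a_t`), `b_t = √((a_t.a_t)/(b′_t.b′_t)) b′_t` and `x_t = a_t + i b_t`.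
Then `a_t, b_t ⊥ h`, `(a_t.b_t) = 0`, `(b_t.b_t) = (a_t.a_t)`, so `x_t ∈ D_h` as soon as
`(a_t.a_t) > 0` and `(b′_t.b′_t) > 0` (`locPath_mem`); `x_0 = x₀` and, for `z ∈ D_h`, `x_1 = z`
(`locPath_endpoint`). The map `(z, t) ↦ x_t` is continuous where the two denominators do not vanish
(`locPath_continuousAt`), and at `z = x₀` it is the constant path `x₀` with denominators
`(a₀.a₀), (b₀.b₀) > 0`; by compactness of `[0, 1]` (tube lemma,
`IsCompact.eventually_forall_of_forall_eventually`) there is an open `V ∋ x₀` on which, for all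
`t ∈ [0, 1]`, both denominators are positive and `x_t ∈ B(x₀, ε)`. For `z ∈ V ∩ D_h` the path
`t ↦ x_t` then joins `x₀` to `z` inside `D_h ∩ B(x₀, ε)` (`JoinedIn.ofLine`). The hypothesis
`h² > 0` of the registered signature is not used.

References: [Huybrechts2016K3] Ch. 6 §1.1 (the period domain `D`), Prop. 1.5 (`D` as oriented
positive planes), §2.4 (`D_h = D ∩ ℙ(h_ℂ^⊥)`).
-/

noncomputable section

set_option linter.dupNamespace false

open Literature.AlgebraicGeometry.Surfaces
open Summit.HodgeConjecture.HodgeConjecture.Theorems.NikulinSerreCarrier.NeronSeveriIntertwiner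
open Topology Filter

namespace Summit.HodgeConjecture.HodgeConjecture.Theorems.NikulinTwinTransport

/-- `GS[B, a, b] = b − ((b.a)/(a.a)) a`: the Gram–Schmidt projection of `b` to `a^⊥` for the
bilinear form `B`. Local notation only. -/
local notation3 (prettyPrint := false) "GS[" B ", " a ", " b "]" =>
  ((b : K3Index → ℝ) - ((B : LinearMap.BilinForm ℝ (K3Index → ℝ)) b a / B a a) • (a : K3Index → ℝ))

/-- `Per[B, a, b] = a + i √((a.a)/(b′.b′)) b′ ∈ Λ_ℂ`, `b′ = GS[B, a, b]`: the period vector with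
real part `a` built from the pair `(a, b)` (Huybrechts Ch. 6 Prop. 1.5, `(e₁, e₂) ↦ e₁ + i e₂`).
Local notation only. -/
local notation3 (prettyPrint := false) "Per[" B ", " a ", " b "]" =>
  (fun i : K3Index => (((a : K3Index → ℝ) i : ℝ) : ℂ) +
    (((Real.sqrt ((B : LinearMap.BilinForm ℝ (K3Index → ℝ)) a a / B (GS[B, a, b]) (GS[B, a, b])) •
      GS[B, a, b]) i : ℝ) : ℂ) * Complex.I)

/-! ### The polarised period domain in terms of the real K3 form -/

/-- **`D_h` via real and imaginary parts** (Huybrechts Ch. 6 Prop. 1.5 and §2.4): `x ∈ D_h` iff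
`(Re x . Im x) = 0`, `(Re x)² = (Im x)² > 0` and `(h . Re x) = (h . Im x) = 0`, for the real K3
form. [cite: Huybrechts2016K3, Ch. 6 Prop. 1.5 and §2.4] -/
theorem mem_polarisedPeriodDomain_iff_k3RForm {B : LinearMap.BilinForm ℝ (K3Index → ℝ)}
    (hB : B = Matrix.toBilin' (k3Gram.map (Int.cast : ℤ → ℝ))) (h : K3Index → ℤ)
    (x : K3Index → ℂ) :
    x ∈ polarisedPeriodDomain h ↔
      (B (fun i => (x i).re) (fun i => (x i).im) = 0 ∧
        B (fun i => (x i).re) (fun i => (x i).re) = B (fun i => (x i).im) (fun i => (x i).im) ∧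
        0 < B (fun i => (x i).re) (fun i => (x i).re)) ∧
      B (fun i => (h i : ℝ)) (fun i => (x i).re) = 0 ∧
      B (fun i => (h i : ℝ)) (fun i => (x i).im) = 0 := by
  have hcC : (fun i => (h i : ℂ)) = fun i => (((h i : ℝ) : ℝ) : ℂ) := by
    funext i; simp
  have hx : x = (fun i => (((x i).re : ℝ) : ℂ)) + Complex.I • (fun i => (((x i).im : ℝ) : ℂ)) := by
    funext i; apply Complex.ext <;> simp
  have hhx : k3Form (fun i => (h i : ℂ)) x =
      ((B (fun i => (h i : ℝ)) (fun i => (x i).re) : ℝ) : ℂ) +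
        Complex.I * ((B (fun i => (h i : ℝ)) (fun i => (x i).im) : ℝ) : ℂ) := by
    rw [hcC]
    conv_lhs => rw [hx]
    rw [k3Form_add_right, k3Form_smul_right, k3Form_ofReal_eq_k3RForm, k3Form_ofReal_eq_k3RForm, hB]
  constructor
  · rintro ⟨hxx, hpos, hhx0⟩
    refine ⟨(mem_k3PeriodDomain_iff_k3RForm hB x).1 ⟨hxx, hpos⟩, ?_⟩
    rw [hcC] at hhx0
    have := k3Real_orthogonal_re_im hhx0
    rwa [← hB] at this
  · rintro ⟨hD, h1, h2⟩
    obtain ⟨hxx, hpos⟩ := (mem_k3PeriodDomain_iff_k3RForm hB x).2 hD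
    refine ⟨hxx, hpos, ?_⟩
    rw [hhx, h1, h2]
    simp

/-- **Period vectors of `D_h` from real pairs** (Huybrechts Ch. 6 Prop. 1.5, the map
`(e₁, e₂) ↦ e₁ + i e₂`, polarised): for real `u ⊥ w` with `(u.u) = (w.w) > 0` and `u, w ⊥ h`, the
vector `u + i w` lies in `D_h`. [cite: Huybrechts2016K3, Ch. 6 Prop. 1.5 and §2.4] -/
theorem polarisedPeriod_mk_mem {B : LinearMap.BilinForm ℝ (K3Index → ℝ)}
    (hB : B = Matrix.toBilin' (k3Gram.map (Int.cast : ℤ → ℝ))) {h : K3Index → ℤ}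
    {u w : K3Index → ℝ} (huw : B u w = 0) (huu : B u u = B w w) (hu : 0 < B u u)
    (hcu : B (fun i => (h i : ℝ)) u = 0) (hcw : B (fun i => (h i : ℝ)) w = 0) :
    (fun i => (u i : ℂ) + (w i : ℂ) * Complex.I) ∈ polarisedPeriodDomain h := by
  rw [mem_polarisedPeriodDomain_iff_k3RForm hB]
  have hre : ∀ i, ((u i : ℂ) + (w i : ℂ) * Complex.I).re = u i := fun i => by simp
  have him : ∀ i, ((u i : ℂ) + (w i : ℂ) * Complex.I).im = w i := fun i => by simp
  simp only [hre, him]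
  exact ⟨⟨huw, huu, hu⟩, hcu, hcw⟩

/-! ### The explicit local paths: endpoints, membership in `D_h`, continuity -/

/-- **Endpoints.** If already `b ⊥ a` and `(a.a) = (b.b) > 0`, the Gram–Schmidt step and the
normalisation do nothing: `Per[B, a, b] = a + i b`. [folklore] -/
theorem locPath_endpoint {B : LinearMap.BilinForm ℝ (K3Index → ℝ)} {a b : K3Index → ℝ}
    (hba : B b a = 0) (haa : B a a = B b b) (ha : 0 < B a a) :
    Per[B, a, b] = fun i => (a i : ℂ) + (b i : ℂ) * Complex.I := by
  have hb' : GS[B, a, b] = b := by rw [hba, zero_div, zero_smul, sub_zero]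
  rw [hb', ← haa, div_self ha.ne', Real.sqrt_one, one_smul]

/-- **Membership.** For `(a.a) > 0`, `(b′.b′) > 0` (`b′ = GS[B, a, b]`) and `a, b ⊥ h`, the vector
`Per[B, a, b] = a + i √((a.a)/(b′.b′)) b′` lies in `D_h`: `a ⊥ b′`, the squares agree after the
normalisation, and `b′ ⊥ h` as a combination of `a, b`.
[cite: Huybrechts2016K3, Ch. 6 Prop. 1.5 and §2.4] -/
theorem locPath_mem {B : LinearMap.BilinForm ℝ (K3Index → ℝ)}
    (hB : B = Matrix.toBilin' (k3Gram.map (Int.cast : ℤ → ℝ))) {h : K3Index → ℤ}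
    {a b : K3Index → ℝ} (ha : 0 < B a a) (hb : 0 < B (GS[B, a, b]) (GS[B, a, b]))
    (hca : B (fun i => (h i : ℝ)) a = 0) (hcb : B (fun i => (h i : ℝ)) b = 0) :
    Per[B, a, b] ∈ polarisedPeriodDomain h := by
  have hBs : ∀ u w, B u w = B w u := fun u w => by rw [hB]; exact k3RForm_comm u w
  have hab' : B a (GS[B, a, b]) = 0 := by
    rw [LinearMap.BilinForm.sub_right, LinearMap.BilinForm.smul_right, hBs a b,
      div_mul_cancel₀ _ ha.ne', sub_self]
  have hcb' : B (fun i => (h i : ℝ)) (GS[B, a, b]) = 0 := by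
    rw [LinearMap.BilinForm.sub_right, LinearMap.BilinForm.smul_right, hca, hcb, mul_zero, sub_zero]
  refine polarisedPeriod_mk_mem hB ?_ ?_ ha hca ?_
  · rw [LinearMap.BilinForm.smul_right, hab', mul_zero]
  · rw [LinearMap.BilinForm.smul_left, LinearMap.BilinForm.smul_right, ← mul_assoc,
      Real.mul_self_sqrt (div_nonneg ha.le hb.le), div_mul_cancel₀ _ hb.ne']
  · rw [LinearMap.BilinForm.smul_right, hcb', mul_zero]

/-- The real K3 form is (jointly) continuous. [folklore] -/
theorem k3RForm_continuous {B : LinearMap.BilinForm ℝ (K3Index → ℝ)}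
    (hB : B = Matrix.toBilin' (k3Gram.map (Int.cast : ℤ → ℝ))) :
    Continuous fun q : (K3Index → ℝ) × (K3Index → ℝ) => B q.1 q.2 := by
  subst hB
  simp only [k3RForm_apply]
  fun_prop

/-- The real K3 form of two maps continuous at a point is continuous at that point. [folklore] -/
theorem k3RForm_continuousAt₂ {B : LinearMap.BilinForm ℝ (K3Index → ℝ)}
    (hB : B = Matrix.toBilin' (k3Gram.map (Int.cast : ℤ → ℝ))) {X : Type*} [TopologicalSpace X]
    {f g : X → K3Index → ℝ} {p : X} (hf : ContinuousAt f p) (hg : ContinuousAt g p) :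
    ContinuousAt (fun q => B (f q) (g q)) p :=
  (k3RForm_continuous hB).continuousAt.comp (hf.prodMk hg)

/-- **Continuity of the Gram–Schmidt step** `q ↦ GS[B, A q, C q]` at a point where
`(A.A) ≠ 0`. [folklore] -/
theorem locGS_continuousAt {B : LinearMap.BilinForm ℝ (K3Index → ℝ)}
    (hB : B = Matrix.toBilin' (k3Gram.map (Int.cast : ℤ → ℝ))) {X : Type*} [TopologicalSpace X]
    {A C : X → K3Index → ℝ} {p : X} (hA : ContinuousAt A p) (hC : ContinuousAt C p)
    (h₁ : B (A p) (A p) ≠ 0) :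
    ContinuousAt (fun q => GS[B, A q, C q]) p :=
  hC.sub (((k3RForm_continuousAt₂ hB hC hA).div₀ (k3RForm_continuousAt₂ hB hA hA) h₁).smul hA)

/-- **Continuity of the path map** `q ↦ Per[B, A q, C q]` at a point where both denominators
`(A.A)` and `(b′.b′)`, `b′ = GS[B, A, C]`, are non-zero (division and `√` are continuous there).
[folklore] -/
theorem locPath_continuousAt {B : LinearMap.BilinForm ℝ (K3Index → ℝ)}
    (hB : B = Matrix.toBilin' (k3Gram.map (Int.cast : ℤ → ℝ))) {X : Type*} [TopologicalSpace X]
    {A C : X → K3Index → ℝ} {p : X} (hA : ContinuousAt A p) (hC : ContinuousAt C p)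
    (h₁ : B (A p) (A p) ≠ 0) (h₂ : B (GS[B, A p, C p]) (GS[B, A p, C p]) ≠ 0) :
    ContinuousAt (fun q => Per[B, A q, C q]) p := by
  have hGS := locGS_continuousAt hB hA hC h₁
  have hs : ContinuousAt
      (fun q => Real.sqrt (B (A q) (A q) / B (GS[B, A q, C q]) (GS[B, A q, C q]))) p :=
    ((k3RForm_continuousAt₂ hB hA hA).div₀ (k3RForm_continuousAt₂ hB hGS hGS) h₂).sqrt
  have hw := hs.smul hGS
  have hΦ : Continuous fun q : (K3Index → ℝ) × (K3Index → ℝ) =>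
      fun i : K3Index => ((q.1 i : ℝ) : ℂ) + ((q.2 i : ℝ) : ℂ) * Complex.I := by
    fun_prop
  exact hΦ.continuousAt.comp (hA.prodMk hw)

/-- **`PeriodDomainLocPathConnected`** — registered stub `stub_periodDomainLocPathConnected` of the
line `reduced-virtual-count-twin-locus`, proved: for `h ∈ Λ` (the hypothesis `h² > 0` is not
needed), `x₀ ∈ D_h` and `ε > 0` there is an open `V ∋ x₀` all of whose points in `D_h` are joined
to `x₀` by a path inside `D_h ∩ B(x₀, ε)` — the polarised period domain is locally path-connected.
Proof: the explicit paths `t ↦ Per[B, a_t, c_t]`, `a_t = (1−t) Re x₀ + t Re z`,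
`c_t = (1−t) Im x₀ + t Im z` (Gram–Schmidt + normalisation of the interpolated frame), which stay in
`D_h` (`locPath_mem`), have the right endpoints (`locPath_endpoint`), and stay `ε`-close to `x₀` for
`z` near `x₀`, uniformly in `t ∈ [0, 1]` by the tube lemma.
[cite: Huybrechts2016K3, Ch. 6 §1.1, Prop. 1.5 and §2.4 (`D`, `D_h` are manifolds)] -/
theorem stub_periodDomainLocPathConnected :
    ∀ (h : K3Index → ℤ), 0 < ∑ i, ∑ j, h i * k3Gram i j * h j →
      ∀ x₀ ∈ polarisedPeriodDomain h, ∀ ε : ℝ, 0 < ε →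
        ∃ V : Set (K3Index → ℂ), IsOpen V ∧ x₀ ∈ V ∧
          ∀ z ∈ V, z ∈ polarisedPeriodDomain h →
            JoinedIn (polarisedPeriodDomain h ∩ Metric.ball x₀ ε) x₀ z := by
  intro h _ x₀ hx₀ ε hε
  obtain ⟨B, hB⟩ : ∃ B : LinearMap.BilinForm ℝ (K3Index → ℝ),
      B = Matrix.toBilin' (k3Gram.map (Int.cast : ℤ → ℝ)) := ⟨_, rfl⟩
  have hBs : ∀ u w, B u w = B w u := fun u w => by rw [hB]; exact k3RForm_comm u w
  -- the frame `(a₀, b₀) = (Re x₀, Im x₀)`: orthogonal, equal positive squares, `⊥ h`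
  obtain ⟨⟨hab₀, haabb₀, ha₀⟩, hca₀, hcb₀⟩ := (mem_polarisedPeriodDomain_iff_k3RForm hB h x₀).1 hx₀
  obtain ⟨a₀, ha₀_def⟩ : ∃ a₀ : K3Index → ℝ, a₀ = fun i => (x₀ i).re := ⟨_, rfl⟩
  obtain ⟨b₀, hb₀_def⟩ : ∃ b₀ : K3Index → ℝ, b₀ = fun i => (x₀ i).im := ⟨_, rfl⟩
  rw [← ha₀_def, ← hb₀_def] at hab₀ haabb₀
  rw [← ha₀_def] at ha₀ hca₀
  rw [← hb₀_def] at hcb₀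
  have hb₀ : 0 < B b₀ b₀ := haabb₀ ▸ ha₀
  have hx₀eq : x₀ = fun i => (a₀ i : ℂ) + (b₀ i : ℂ) * Complex.I := by
    rw [ha₀_def, hb₀_def]; funext i; exact (Complex.re_add_im (x₀ i)).symm
  -- the interpolated real data `a_t = A z t`, `c_t = C z t` and the path map `Φ z t`
  obtain ⟨A, hA⟩ : ∃ A : (K3Index → ℂ) → ℝ → K3Index → ℝ,
      ∀ z t, A z t = (1 - t) • a₀ + t • fun i => (z i).re := ⟨_, fun _ _ => rfl⟩
  obtain ⟨C, hC⟩ : ∃ C : (K3Index → ℂ) → ℝ → K3Index → ℝ,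
      ∀ z t, C z t = (1 - t) • b₀ + t • fun i => (z i).im := ⟨_, fun _ _ => rfl⟩
  obtain ⟨Φ, hΦ⟩ : ∃ Φ : (K3Index → ℂ) → ℝ → K3Index → ℂ,
      ∀ z t, Φ z t = Per[B, A z t, C z t] := ⟨_, fun _ _ => rfl⟩
  have hAc : Continuous fun p : (K3Index → ℂ) × ℝ => A p.1 p.2 := by
    simp only [hA]; fun_prop
  have hCc : Continuous fun p : (K3Index → ℂ) × ℝ => C p.1 p.2 := by
    simp only [hC]; fun_prop
  -- special values
  have hconv : ∀ (t : ℝ) (v : K3Index → ℝ), (1 - t) • v + t • v = v := fun t v => by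
    rw [← add_smul, sub_add_cancel, one_smul]
  have hAx₀ : ∀ t, A x₀ t = a₀ := fun t => by rw [hA, ← ha₀_def, hconv]
  have hCx₀ : ∀ t, C x₀ t = b₀ := fun t => by rw [hC, ← hb₀_def, hconv]
  have hA0 : ∀ z, A z 0 = a₀ := fun z => by rw [hA, sub_zero, one_smul, zero_smul, add_zero]
  have hC0 : ∀ z, C z 0 = b₀ := fun z => by rw [hC, sub_zero, one_smul, zero_smul, add_zero]
  have hA1 : ∀ z, A z 1 = fun i => (z i).re := fun z => by
    rw [hA, sub_self, zero_smul, one_smul, zero_add]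
  have hC1 : ∀ z, C z 1 = fun i => (z i).im := fun z => by
    rw [hC, sub_self, zero_smul, one_smul, zero_add]
  have hb₀a₀ : B b₀ a₀ = 0 := by rw [hBs]; exact hab₀
  have hGS₀ : GS[B, a₀, b₀] = b₀ := by rw [hb₀a₀, zero_div, zero_smul, sub_zero]
  have hΦx₀ : ∀ t, Φ x₀ t = x₀ := fun t => by
    rw [hΦ, hAx₀, hCx₀, locPath_endpoint hb₀a₀ haabb₀ ha₀, hx₀eq]
  -- joint continuity of the path map where the two denominators do not vanish
  have hΦc : ∀ z t, B (A z t) (A z t) ≠ 0 → B (GS[B, A z t, C z t]) (GS[B, A z t, C z t]) ≠ 0 →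
      ContinuousAt (fun p : (K3Index → ℂ) × ℝ => Φ p.1 p.2) (z, t) := by
    intro z t h₁ h₂
    have e : (fun p : (K3Index → ℂ) × ℝ => Φ p.1 p.2) = fun p => Per[B, A p.1 p.2, C p.1 p.2] :=
      funext fun p => hΦ p.1 p.2
    rw [e]
    exact locPath_continuousAt hB (p := (z, t)) hAc.continuousAt hCc.continuousAt h₁ h₂
  -- near `(x₀, t)`, for every `t`: both denominators positive and the path point `ε`-close to `x₀`
  have key : ∀ t : ℝ, ∀ᶠ p : (K3Index → ℂ) × ℝ in 𝓝 (x₀, t),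
      (0 < B (A p.1 p.2) (A p.1 p.2) ∧
        0 < B (GS[B, A p.1 p.2, C p.1 p.2]) (GS[B, A p.1 p.2, C p.1 p.2])) ∧
      Φ p.1 p.2 ∈ Metric.ball x₀ ε := by
    intro t
    have h₁ : 0 < B (A x₀ t) (A x₀ t) := by rw [hAx₀]; exact ha₀
    have h₂ : 0 < B (GS[B, A x₀ t, C x₀ t]) (GS[B, A x₀ t, C x₀ t]) := by
      rw [hAx₀, hCx₀, hGS₀]; exact hb₀
    have hGSc := locGS_continuousAt hB (p := (x₀, t)) hAc.continuousAt hCc.continuousAt h₁.ne'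
    have e₁ : ∀ᶠ p : (K3Index → ℂ) × ℝ in 𝓝 (x₀, t), 0 < B (A p.1 p.2) (A p.1 p.2) :=
      continuousAt_const.eventually_lt
        (k3RForm_continuousAt₂ hB (p := (x₀, t)) hAc.continuousAt hAc.continuousAt) h₁
    have e₂ : ∀ᶠ p : (K3Index → ℂ) × ℝ in 𝓝 (x₀, t),
        0 < B (GS[B, A p.1 p.2, C p.1 p.2]) (GS[B, A p.1 p.2, C p.1 p.2]) :=
      continuousAt_const.eventually_lt (k3RForm_continuousAt₂ hB hGSc hGSc) h₂
    have e₃ : ∀ᶠ p : (K3Index → ℂ) × ℝ in 𝓝 (x₀, t), Φ p.1 p.2 ∈ Metric.ball x₀ ε := by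
      refine (hΦc x₀ t h₁.ne' h₂.ne').eventually_mem ?_
      show Metric.ball x₀ ε ∈ 𝓝 (Φ x₀ t)
      rw [hΦx₀]
      exact Metric.ball_mem_nhds x₀ hε
    exact (e₁.and e₂).and e₃
  -- tube lemma over the compact parameter interval `[0, 1]`
  obtain ⟨V, hV, hVopen, hx₀V⟩ := eventually_nhds_iff.1
    ((isCompact_Icc : IsCompact (Set.Icc (0 : ℝ) 1)).eventually_forall_of_forall_eventually
      (P := fun z t => (0 < B (A z t) (A z t) ∧
        0 < B (GS[B, A z t, C z t]) (GS[B, A z t, C z t])) ∧ Φ z t ∈ Metric.ball x₀ ε)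
      fun t _ => key t)
  refine ⟨V, hVopen, hx₀V, fun z hz hzD => ?_⟩
  have hP := hV z hz
  obtain ⟨⟨hab₁, haabb₁, ha₁⟩, hca₁, hcb₁⟩ := (mem_polarisedPeriodDomain_iff_k3RForm hB h z).1 hzD
  -- the interpolated data stay orthogonal to `h`
  have hcA : ∀ t, B (fun i => (h i : ℝ)) (A z t) = 0 := fun t => by
    rw [hA, LinearMap.BilinForm.add_right, LinearMap.BilinForm.smul_right,
      LinearMap.BilinForm.smul_right, hca₀, hca₁, mul_zero, mul_zero, add_zero]
  have hcC : ∀ t, B (fun i => (h i : ℝ)) (C z t) = 0 := fun t => by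
    rw [hC, LinearMap.BilinForm.add_right, LinearMap.BilinForm.smul_right,
      LinearMap.BilinForm.smul_right, hcb₀, hcb₁, mul_zero, mul_zero, add_zero]
  refine JoinedIn.ofLine (f := Φ z) (fun t ht => ?_) ?_ ?_ ?_
  · -- continuity on `[0, 1]`
    obtain ⟨⟨h₁, h₂⟩, -⟩ := hP t ht
    exact ((hΦc z t h₁.ne' h₂.ne').comp (Continuous.prodMk_right z).continuousAt).continuousWithinAt
  · -- source `x₀`
    rw [hΦ, hA0, hC0, locPath_endpoint hb₀a₀ haabb₀ ha₀, hx₀eq]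
  · -- target `z`
    rw [hΦ, hA1, hC1, locPath_endpoint (by rw [hBs]; exact hab₁) haabb₁ ha₁]
    funext i
    exact Complex.re_add_im (z i)
  · -- the path lies in `D_h ∩ B(x₀, ε)`
    rintro _ ⟨t, ht, rfl⟩
    obtain ⟨⟨h₁, h₂⟩, hball⟩ := hP t ht
    refine ⟨?_, hball⟩
    rw [hΦ]
    exact locPath_mem hB h₁ h₂ (hcA t) (hcC t)

end Summit.HodgeConjecture.HodgeConjecture.Theorems.NikulinTwinTransport

end
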